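import Mathlib
import Literature.Analysis.FluidPDE.VectorCalculus
import Summits.NavierStokesRegularity.NavierStokesRegularity.Theorems.FilamentSkeletonRssClause13RAdjointWaistSourcedLeft
import Summits.NavierStokesRegularity.NavierStokesRegularity.Theorems.FilamentSkeletonRssClause13RAdjointWaistBranch

/-!
# Clause 13-R, STUB R at MODEL level: the waist-regular LOCAL SOLUTION OPERATOR is a bounded linear map on `C(S; ℝ³)`
# (census item (R-c′-E), global half, ingredient 2; crux `Clause13RNearStraightL`, stmt-NavierStokesRegularity-23612; line `rate_bordered_split`,
# STUB R `stub_rateRow13RFlat`)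

Route `FilamentSkeletonRss`, Variant A1R.  `…Clause13RAdjointWaistBranch.exists_continuous_waistRegular_branch` (p837123) produces, for every continuous
source `g`, ONE continuous density on a ball around the stagnation point `c` of the slip solving the sourced local MODEL adjoint equation
`w φ′ + ½φ + w′φ + α e × φ + cst·m (φ × d) = g` off the waist, the algebraic waist equation at `c`, and `‖φ‖ ≤ sup‖g‖/κ₁`.  THIS FILE (def-free):
* `waist_branch_unique` — that density is UNIQUE among bounded solutions (right of the waist `…WaistSourced.waistRegular_unique_right`, left of the waist
  `…WaistSourcedLeft.eq_zero_of_waistRegular_left` on the difference, at the waist `…WaistContinuity.waistValue_unique`);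
* `exists_waist_solutionOperator` — hence **the local solution operator `Φ : g ↦ φ|_{[a,b]}` is a BOUNDED LINEAR OPERATOR on `Icc a b →ᵇ ℝ³`
  (`= C([a,b]; ℝ³)`), `‖Φ‖ ≤ 1/κ₁`**, sources on `[a, b]` being extended constantly to the slightly larger open interval `(a₀, b₀) ⊃ [a, b]` on which the
  slip opens linearly; the theorem also returns the underlying functions `Ψ g, Ψ′ g : ℝ → ℝ³` with their equation, so that a fixed point of
  `Φ ∘ (source map)` can be read back as a punctured solution on `[a, b]` with two-sided derivatives at the endpoints (the input class of
  `…Clause13RAdjointPunctured(Unique/Apriori)` p832184/p832285/p832351).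
Together with `…Clause13RAdjointNonlocalCompact` (the nonlocal term is compact) this is the operator-theoretic packaging of census item (R-c′-E) for the
Fredholm alternative (`IsCompactOperator.hasEigenvalue_or_mem_resolventSet`).  [folklore]
Hand `leafhand-ns-filamentskeletonrs-25-g0` (LAND-ONLY); `--supports stmt-NavierStokesRegularity-23612` helper, def-free.  HONEST FRAMING: functional-analytic
bookkeeping for the MODEL adjoint equation attached to a HYPOTHETICAL filament skeleton on the NEGATIVE side of a MODEL blow-up route; STUB R is NOT proved
here and nothing in this file bears on Navier–Stokes regularity or blow-up.
-/

noncomputable section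

open MeasureTheory Filter Topology Set Metric
open scoped RealInnerProductSpace InnerProductSpace BoundedContinuousFunction
open Literature.Analysis.FluidPDE
open Summit.NavierStokesRegularity.NavierStokesRegularity.Theorems.Clause13RAdjointWaistSourced
  (waistRegular_unique_right waistRegular_of_bounded_right)
open Summit.NavierStokesRegularity.NavierStokesRegularity.Theorems.Clause13RAdjointWaistSourcedLeft (eq_zero_of_waistRegular_left)
open Summit.NavierStokesRegularity.NavierStokesRegularity.Theorems.Clause13RAdjointWaistExistence (homogeneous_of_sub)
open Summit.NavierStokesRegularity.NavierStokesRegularity.Theorems.Clause13RAdjointWaistContinuity (waistValue_unique)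
open Summit.NavierStokesRegularity.NavierStokesRegularity.Theorems.Clause13RAdjointWaistBranch
  (deriv_ge_of_linear_opening exists_continuous_waistRegular_branch)

namespace Summit.NavierStokesRegularity.NavierStokesRegularity.Theorems.Clause13RAdjointWaistOperator
set_option linter.dupNamespace false

/-! ## §1 Linear algebra of the local form -/

/-- The local adjoint form is additive in `(φ′, φ)`. [folklore] -/
theorem localForm_add (wv wp α cm : ℝ) (y₁ y₂ x₁ x₂ d e : EuclideanSpace ℝ (Fin 3)) :
    wv • (y₁ + y₂) + (1 / 2 : ℝ) • (x₁ + x₂) + wp • (x₁ + x₂) + α • cross e (x₁ + x₂) + cm • cross (x₁ + x₂) d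
      = (wv • y₁ + (1 / 2 : ℝ) • x₁ + wp • x₁ + α • cross e x₁ + cm • cross x₁ d)
        + (wv • y₂ + (1 / 2 : ℝ) • x₂ + wp • x₂ + α • cross e x₂ + cm • cross x₂ d) := by
  have hc1 : cross e (x₁ + x₂) = cross e x₁ + cross e x₂ := by rw [← crossCLM_apply, map_add]; rfl
  have hc2 : cross (x₁ + x₂) d = cross x₁ d + cross x₂ d := by rw [← crossCLM_apply, map_add, _root_.add_apply]; rfl
  rw [hc1, hc2]
  simp only [smul_add]
  abel

/-- The local adjoint form is homogeneous in `(φ′, φ)`. [folklore] -/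
theorem localForm_smul (wv wp α cm r : ℝ) (y x d e : EuclideanSpace ℝ (Fin 3)) :
    wv • (r • y) + (1 / 2 : ℝ) • (r • x) + wp • (r • x) + α • cross e (r • x) + cm • cross (r • x) d
      = r • (wv • y + (1 / 2 : ℝ) • x + wp • x + α • cross e x + cm • cross x d) := by
  have hc1 : cross e (r • x) = r • cross e x := by rw [← crossCLM_apply, map_smul]; rfl
  have hc2 : cross (r • x) d = r • cross x d := by rw [← crossCLM_apply, map_smul, _root_.smul_apply]; rfl
  rw [hc1, hc2]
  simp only [smul_add, smul_smul, mul_comm r]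

/-- A branch bounded near `c⁻` is waist-regular from the left as soon as `w → 0` at `c⁻` (mirror of
`…WaistSourced.waistRegular_of_bounded_right`). [folklore] -/
theorem waistRegular_of_bounded_left {c M : ℝ} {w : ℝ → ℝ} {φ : ℝ → EuclideanSpace ℝ (Fin 3)}
    (hwc : Tendsto w (𝓝[<] c) (𝓝 0)) (hM : ∀ᶠ s in 𝓝[<] c, ‖φ s‖ ≤ M) :
    Tendsto (fun s => w s * ‖φ s‖) (𝓝[<] c) (𝓝 0) := by
  refine squeeze_zero_norm' (a := fun s => |w s| * M) ?_ ?_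
  · filter_upwards [hM] with s hs
    rw [norm_mul, Real.norm_eq_abs, Real.norm_eq_abs, abs_norm]
    exact mul_le_mul_of_nonneg_left hs (abs_nonneg _)
  · simpa using hwc.abs.mul_const M

/-! ## §2 Uniqueness of the continuous bounded branch on the whole ball -/

/-- **UNIQUENESS of the bounded branch across the waist.**  On a ball `(a₀, b₀) ∋ c` where the `C¹` slip vanishes at `c` and opens at least linearly on
both sides, two solutions of the sourced local adjoint equation off the waist (same source), both BOUNDED on the punctured ball and both satisfying
the algebraic waist equation at `c`, coincide on the whole ball. [folklore] -/
theorem waist_branch_unique {a₀ b₀ c κ₁ cst α M₁ M₂ : ℝ} {m w w' : ℝ → ℝ} {ψ₁ ψ₁' ψ₂ ψ₂' g : ℝ → EuclideanSpace ℝ (Fin 3)}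
    {d e : EuclideanSpace ℝ (Fin 3)} (ha : a₀ < c) (hb : c < b₀) (hκ₁ : 0 < κ₁)
    (hw : ∀ s, HasDerivAt w (w' s) s) (hwc0 : w c = 0)
    (hwR : ∀ s ∈ Icc c b₀, κ₁ * (s - c) ≤ w s) (hwL : ∀ s ∈ Icc a₀ c, κ₁ * (c - s) ≤ -w s)
    (h₁d : ∀ s ∈ Ioo a₀ b₀, s ≠ c → HasDerivAt ψ₁ (ψ₁' s) s)
    (h₁eq : ∀ s ∈ Ioo a₀ b₀, s ≠ c →
      w s • ψ₁' s + (1 / 2 : ℝ) • ψ₁ s + w' s • ψ₁ s + α • cross e (ψ₁ s) + (cst * m s) • cross (ψ₁ s) d = g s)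
    (h₁c : (1 / 2 : ℝ) • ψ₁ c + w' c • ψ₁ c + α • cross e (ψ₁ c) + (cst * m c) • cross (ψ₁ c) d = g c)
    (h₁b : ∀ s ∈ Ioo a₀ b₀, ‖ψ₁ s‖ ≤ M₁)
    (h₂d : ∀ s ∈ Ioo a₀ b₀, s ≠ c → HasDerivAt ψ₂ (ψ₂' s) s)
    (h₂eq : ∀ s ∈ Ioo a₀ b₀, s ≠ c →
      w s • ψ₂' s + (1 / 2 : ℝ) • ψ₂ s + w' s • ψ₂ s + α • cross e (ψ₂ s) + (cst * m s) • cross (ψ₂ s) d = g s)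
    (h₂c : (1 / 2 : ℝ) • ψ₂ c + w' c • ψ₂ c + α • cross e (ψ₂ c) + (cst * m c) • cross (ψ₂ c) d = g c)
    (h₂b : ∀ s ∈ Ioo a₀ b₀, ‖ψ₂ s‖ ≤ M₂) :
    ∀ s ∈ Ioo a₀ b₀, ψ₁ s = ψ₂ s := by
  have hwcont : Continuous w := continuous_iff_continuousAt.2 fun s => (hw s).continuousAt
  have hw0 : Tendsto w (𝓝 c) (𝓝 0) := by simpa [hwc0] using hwcont.continuousAt.tendsto (x := c)
  intro s hs
  rcases lt_trichotomy s c with hlt | heq | hgt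
  · -- left of the waist: the difference is a waist-regular solution of the homogeneous equation
    have hsub : Ico s c ⊆ Ioo a₀ b₀ := fun x hx => ⟨lt_of_lt_of_le hs.1 hx.1, hx.2.trans hb⟩
    have hne : ∀ x ∈ Ico s c, x ≠ c := fun x hx => ne_of_lt hx.2
    have hwnp : ∀ x ∈ Ico s c, w x ≤ 0 := fun x hx => by
      have := hwL x ⟨(lt_of_lt_of_le hs.1 hx.1).le, hx.2.le⟩
      nlinarith [mul_nonneg hκ₁.le (sub_nonneg.2 hx.2.le)]
    have hreg : Tendsto (fun x => w x * ‖ψ₁ x - ψ₂ x‖) (𝓝[<] c) (𝓝 0) := by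
      refine waistRegular_of_bounded_left (M := M₁ + M₂) (hw0.mono_left nhdsWithin_le_nhds) ?_
      exact eventually_of_mem (Ico_mem_nhdsLT hlt) fun x hx => (norm_sub_le _ _).trans (add_le_add (h₁b x (hsub hx)) (h₂b x (hsub hx)))
    have h := eq_zero_of_waistRegular_left (σ₁ := s) (φ := fun x => ψ₁ x - ψ₂ x) (φ' := fun x => ψ₁' x - ψ₂' x)
      (fun x _ => hw x) (fun x hx => (h₁d x (hsub hx) (hne x hx)).sub (h₂d x (hsub hx) (hne x hx))) hwnp
      (fun x hx => homogeneous_of_sub (h₁eq x (hsub hx) (hne x hx)) (h₂eq x (hsub hx) (hne x hx))) hreg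
      ⟨le_rfl, hlt⟩ (by have := hwL s ⟨hs.1.le, hlt.le⟩; nlinarith [mul_pos hκ₁ (sub_pos.2 hlt)])
    exact sub_eq_zero.1 h
  · -- at the waist: uniqueness of the algebraic waist value
    subst heq
    have hs' : 0 < 1 / 2 + w' s := by
      have := deriv_ge_of_linear_opening hb (hw s) hwc0 hwR
      linarith
    refine waistValue_unique (α := α) (cm := cst * m s) hs' (d := d) (e := e) (y := g s) ?_ ?_
    · rw [add_smul]; exact h₁c
    · rw [add_smul]; exact h₂c
  · -- right of the waist
    have hsub : Ioc c s ⊆ Ioo a₀ b₀ := fun x hx => ⟨ha.trans hx.1, lt_of_le_of_lt hx.2 hs.2⟩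
    have hne : ∀ x ∈ Ioc c s, x ≠ c := fun x hx => ne_of_gt hx.1
    have hwnn : ∀ x ∈ Ioc c s, 0 ≤ w x := fun x hx =>
      (mul_nonneg hκ₁.le (sub_nonneg.2 hx.1.le)).trans (hwR x ⟨hx.1.le, hx.2.trans hs.2.le⟩)
    have hwc' : Tendsto w (𝓝[>] c) (𝓝 0) := hw0.mono_left nhdsWithin_le_nhds
    have hreg₁ : Tendsto (fun x => w x * ‖ψ₁ x‖) (𝓝[>] c) (𝓝 0) :=
      waistRegular_of_bounded_right hwc' (eventually_of_mem (Ioc_mem_nhdsGT hgt) fun x hx => h₁b x (hsub hx))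
    have hreg₂ : Tendsto (fun x => w x * ‖ψ₂ x‖) (𝓝[>] c) (𝓝 0) :=
      waistRegular_of_bounded_right hwc' (eventually_of_mem (Ioc_mem_nhdsGT hgt) fun x hx => h₂b x (hsub hx))
    exact waistRegular_unique_right hgt (fun x _ => hw x) (fun x hx => h₁d x (hsub hx) (hne x hx))
      (fun x hx => h₂d x (hsub hx) (hne x hx)) hwnn (fun x hx => h₁eq x (hsub hx) (hne x hx))
      (fun x hx => h₂eq x (hsub hx) (hne x hx)) hreg₁ hreg₂ ⟨hgt, le_rfl⟩
      (by have := hwR s ⟨hgt.le, hs.2.le⟩; nlinarith [mul_pos hκ₁ (sub_pos.2 hgt)])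

/-! ## §3 The bounded linear solution operator on `C([a, b]; ℝ³)` -/

/-- **THE WAIST-REGULAR LOCAL SOLUTION OPERATOR IS A BOUNDED LINEAR MAP ON `C([a,b]; ℝ³)`.**  Slip `w ∈ C¹(ℝ)` (`w′` continuous) with `w(c) = 0`,
opening at least linearly on both sides of the waist on an open interval `(a₀, b₀) ⊃ [a, b] ∋ c` (`κ₁ > 0`); continuous weight `m`; constants `α, cst`,
vectors `d, e`.  Then there are a continuous linear `Φ` on `Icc a b →ᵇ ℝ³` and maps `Ψ, Ψ′` such that for every source `h` (extended constantly
to `ℝ`): `Ψ h` is continuous on `(a₀, b₀)`, differentiable off the waist with derivative `Ψ′ h` where it solves the sourced local adjoint equation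
with source `IccExtend h`, satisfies the algebraic waist equation at `c`, is bounded by `‖h‖/κ₁`, and `Φ h` is its restriction to `[a, b]`. [folklore] -/
theorem exists_waist_solutionOperator {a₀ a c b b₀ κ₁ cst α : ℝ} {m w w' : ℝ → ℝ} {d e : EuclideanSpace ℝ (Fin 3)}
    (hab : a ≤ b) (h₀ : a₀ < a) (hac : a < c) (hcb : c < b) (h₁ : b < b₀) (hκ₁ : 0 < κ₁)
    (hw : ∀ s, HasDerivAt w (w' s) s) (hw'c : Continuous w') (hm : Continuous m) (hwc0 : w c = 0)
    (hwR : ∀ s ∈ Icc c b₀, κ₁ * (s - c) ≤ w s) (hwL : ∀ s ∈ Icc a₀ c, κ₁ * (c - s) ≤ -w s) :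
    ∃ (Φ : (Icc a b →ᵇ EuclideanSpace ℝ (Fin 3)) →L[ℝ] (Icc a b →ᵇ EuclideanSpace ℝ (Fin 3)))
      (Ψ Ψ' : (Icc a b →ᵇ EuclideanSpace ℝ (Fin 3)) → ℝ → EuclideanSpace ℝ (Fin 3)),
      ∀ h : Icc a b →ᵇ EuclideanSpace ℝ (Fin 3),
        (∀ σ : Icc a b, Φ h σ = Ψ h σ) ∧
        ContinuousOn (Ψ h) (Ioo a₀ b₀) ∧
        (∀ s ∈ Ioo a₀ b₀, s ≠ c → HasDerivAt (Ψ h) (Ψ' h s) s) ∧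
        (∀ s ∈ Ioo a₀ b₀, s ≠ c →
          w s • Ψ' h s + (1 / 2 : ℝ) • Ψ h s + w' s • Ψ h s + α • cross e (Ψ h s) + (cst * m s) • cross (Ψ h s) d = IccExtend hab h s) ∧
        ((1 / 2 : ℝ) • Ψ h c + w' c • Ψ h c + α • cross e (Ψ h c) + (cst * m c) • cross (Ψ h c) d = IccExtend hab h c) ∧
        (∀ s ∈ Ioo a₀ b₀, ‖Ψ h s‖ ≤ ‖h‖ / κ₁) := by
  have ha₀c : a₀ < c := h₀.trans hac
  have hcb₀ : c < b₀ := hcb.trans h₁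
  -- sources: constant extension of `h` to `ℝ`
  have hgc : ∀ h : Icc a b →ᵇ EuclideanSpace ℝ (Fin 3), Continuous (IccExtend hab h) := fun h => h.continuous.Icc_extend'
  have hgb : ∀ (h : Icc a b →ᵇ EuclideanSpace ℝ (Fin 3)) s, ‖IccExtend hab h s‖ ≤ ‖h‖ := fun h s => by
    rw [IccExtend, Function.comp_apply]; exact h.norm_coe_le_norm _
  have hex : ∀ h : Icc a b →ᵇ EuclideanSpace ℝ (Fin 3), ∃ φ φ' : ℝ → EuclideanSpace ℝ (Fin 3),
      ContinuousOn φ (Ioo a₀ b₀) ∧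
      (∀ s ∈ Ioo a₀ b₀, s ≠ c → HasDerivAt φ (φ' s) s) ∧
      (∀ s ∈ Ioo a₀ b₀, s ≠ c →
        w s • φ' s + (1 / 2 : ℝ) • φ s + w' s • φ s + α • cross e (φ s) + (cst * m s) • cross (φ s) d = IccExtend hab h s) ∧
      ((1 / 2 : ℝ) • φ c + w' c • φ c + α • cross e (φ c) + (cst * m c) • cross (φ c) d = IccExtend hab h c) ∧
      (∀ s ∈ Ioo a₀ b₀, |w s| * ‖φ s‖ ≤ ‖h‖ * |s - c|) ∧
      (∀ s ∈ Ioo a₀ b₀, ‖φ s‖ ≤ ‖h‖ / κ₁) := fun h =>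
    exists_continuous_waistRegular_branch ha₀c hcb₀ hκ₁ hw hw'c hm (hgc h) hwc0 hwR hwL (fun s _ => hgb h s)
  choose Ψ Ψ' hΨc hΨd hΨeq hΨw hΨwb hΨs using hex
  -- restriction to the compact ball
  have hmemI : ∀ σ : Icc a b, (σ : ℝ) ∈ Ioo a₀ b₀ := fun σ => ⟨h₀.trans_le σ.2.1, lt_of_le_of_lt σ.2.2 h₁⟩
  have hres_cont : ∀ h, Continuous fun σ : Icc a b => Ψ h σ := fun h =>
    (hΨc h).comp_continuous continuous_subtype_val hmemI
  set Φf : (Icc a b →ᵇ EuclideanSpace ℝ (Fin 3)) → (Icc a b →ᵇ EuclideanSpace ℝ (Fin 3)) := fun h =>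
    BoundedContinuousFunction.mkOfCompact ⟨fun σ : Icc a b => Ψ h σ, hres_cont h⟩ with hΦf
  have hΦf_apply : ∀ h (σ : Icc a b), Φf h σ = Ψ h σ := fun h σ => rfl
  -- uniqueness package: any bounded solution with the waist equation for the source `IccExtend (h)` equals `Ψ h`
  have huniq : ∀ (h : Icc a b →ᵇ EuclideanSpace ℝ (Fin 3)) (ψ ψ' : ℝ → EuclideanSpace ℝ (Fin 3)) (M : ℝ),
      (∀ s ∈ Ioo a₀ b₀, s ≠ c → HasDerivAt ψ (ψ' s) s) →
      (∀ s ∈ Ioo a₀ b₀, s ≠ c →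
        w s • ψ' s + (1 / 2 : ℝ) • ψ s + w' s • ψ s + α • cross e (ψ s) + (cst * m s) • cross (ψ s) d = IccExtend hab h s) →
      ((1 / 2 : ℝ) • ψ c + w' c • ψ c + α • cross e (ψ c) + (cst * m c) • cross (ψ c) d = IccExtend hab h c) →
      (∀ s ∈ Ioo a₀ b₀, ‖ψ s‖ ≤ M) → ∀ s ∈ Ioo a₀ b₀, ψ s = Ψ h s :=
    fun h ψ ψ' M hd heq hc hb =>
      waist_branch_unique ha₀c hcb₀ hκ₁ hw hwc0 hwR hwL hd heq hc hb (hΨd h) (hΨeq h) (hΨw h) (hΨs h)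
  -- additivity
  have hadd : ∀ h₁' h₂' : Icc a b →ᵇ EuclideanSpace ℝ (Fin 3), Φf (h₁' + h₂') = Φf h₁' + Φf h₂' := by
    intro g₁ g₂
    have hext : ∀ s, IccExtend hab (⇑(g₁ + g₂)) s = IccExtend hab g₁ s + IccExtend hab g₂ s := fun s => by
      simp only [IccExtend, Function.comp_apply, BoundedContinuousFunction.coe_add, Pi.add_apply]
    have key : ∀ s ∈ Ioo a₀ b₀, (fun x => Ψ g₁ x + Ψ g₂ x) s = Ψ (g₁ + g₂) s := by
      refine huniq (g₁ + g₂) (fun x => Ψ g₁ x + Ψ g₂ x) (fun x => Ψ' g₁ x + Ψ' g₂ x) (‖g₁‖ / κ₁ + ‖g₂‖ / κ₁) ?_ ?_ ?_ ?_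
      · intro s hs hsc; exact (hΨd g₁ s hs hsc).add (hΨd g₂ s hs hsc)
      · intro s hs hsc
        rw [localForm_add, hΨeq g₁ s hs hsc, hΨeq g₂ s hs hsc, hext]
      · have h := localForm_add 0 (w' c) α (cst * m c) 0 0 (Ψ g₁ c) (Ψ g₂ c) d e
        simp only [smul_zero, zero_add, add_zero] at h
        rw [h, hΨw g₁, hΨw g₂, hext]
      · intro s hs; exact (norm_add_le _ _).trans (add_le_add (hΨs g₁ s hs) (hΨs g₂ s hs))
    ext σ : 1
    rw [BoundedContinuousFunction.add_apply, hΦf_apply, hΦf_apply, hΦf_apply]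
    exact (key σ (hmemI σ)).symm
  -- homogeneity
  have hsmul : ∀ (r : ℝ) (h₁' : Icc a b →ᵇ EuclideanSpace ℝ (Fin 3)), Φf (r • h₁') = r • Φf h₁' := by
    intro r g₁
    have hext : ∀ s, IccExtend hab (⇑(r • g₁)) s = r • IccExtend hab g₁ s := fun s => by
      simp only [IccExtend, Function.comp_apply, BoundedContinuousFunction.coe_smul]
    have key : ∀ s ∈ Ioo a₀ b₀, (fun x => r • Ψ g₁ x) s = Ψ (r • g₁) s := by
      refine huniq (r • g₁) (fun x => r • Ψ g₁ x) (fun x => r • Ψ' g₁ x) (|r| * (‖g₁‖ / κ₁)) ?_ ?_ ?_ ?_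
      · intro s hs hsc; exact (hΨd g₁ s hs hsc).const_smul r
      · intro s hs hsc
        rw [localForm_smul, hΨeq g₁ s hs hsc, hext]
      · have h := localForm_smul 0 (w' c) α (cst * m c) r 0 (Ψ g₁ c) d e
        simp only [smul_zero, zero_add] at h
        rw [h, hΨw g₁, hext]
      · intro s hs; rw [norm_smul, Real.norm_eq_abs]; exact mul_le_mul_of_nonneg_left (hΨs g₁ s hs) (abs_nonneg _)
    ext σ : 1
    rw [BoundedContinuousFunction.smul_apply, hΦf_apply, hΦf_apply]
    exact (key σ (hmemI σ)).symm
  set Φl : (Icc a b →ᵇ EuclideanSpace ℝ (Fin 3)) →ₗ[ℝ] (Icc a b →ᵇ EuclideanSpace ℝ (Fin 3)) :=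
    { toFun := Φf, map_add' := hadd, map_smul' := hsmul } with hΦl
  have hbound : ∀ h, ‖Φl h‖ ≤ κ₁⁻¹ * ‖h‖ := fun h => by
    have h0 : 0 ≤ κ₁⁻¹ * ‖h‖ := by positivity
    refine (BoundedContinuousFunction.norm_le h0).2 fun σ => ?_
    have := hΨs h σ (hmemI σ)
    rw [div_eq_inv_mul] at this
    exact this
  refine ⟨Φl.mkContinuous κ₁⁻¹ hbound, Ψ, Ψ', fun h => ⟨fun σ => rfl, hΨc h, hΨd h, hΨeq h, hΨw h, hΨs h⟩⟩

end Summit.NavierStokesRegularity.NavierStokesRegularity.Theorems.Clause13RAdjointWaistOperator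

end
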